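import Summits.ABC.StewartYu.PadicG3ParNBudgetA
import Summits.ABC.StewartYu.PadicG3ParNC
import Summits.ABC.StewartYu.PadicG3ExpLineE
import HarnessLib

/-!
# The `𝔑`-threaded odd-`p` record `PadicG3ParN` — file D: the U-FLOOR (headline) at `m = 0` and the generic
# smallness line `∃ U, ‖Λ/b̃_{k₀}‖ ≤ e^{−U} ∧ 8·2ⁿ·Zp + CondFloorN n ≤ U`

Support file (theorems only; no named facts). Cell `abc-stewartyu`, route `YuMatveevShapeRat`, crux r3 `PadicCoreOddRat`
(stmt-ABC-20503); seat p1 (record owner). `CondFloorN ν ≤ 2N·CondFloorV ν ≤ 2(2/log 2)ⁿΩ·CondFloorV ν` (`ŜN ≤ ŜG + ⌊log₂N⌋ + 1`,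
field `hNΩ`); at `m = 0` the landed `main_term_le` (VM) and the Ω-free core of `CondFloorV_le_main` give
`headline_N_zero : 2·(8·2ⁿ·Zp + CondFloorN n) ≤ (2^100)ⁿ·(p/log p)·Ω·Wp`; and `G3Setup.U_floor_of_headline` turns any negated
bound `¬ ord_p(∏αᵇ−1)·log p ≤ R` with `2·(8·2ⁿ·Zp + CondFloorN n) ≤ R` into the `U` of p2's `hKlam_N/hHlam_N`
(`W + log p ≤ 8·2ⁿ·Zp` always). The `m ≥ 1` headline is file E. (Independent of files B/Ac/C.)

## References
* [Yu2013] K. Yu, Acta Math. 211 (2013) — Theorem 1 (shape of the main term), §7.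
-/

noncomputable section

open Finset Real

namespace Summit.ABC.StewartYu

namespace PadicG3ParN

open PadicG3Par (Cb cM cG two_le_Cb Cb_pos sixteen_Cb_le)

variable {n : ℕ} (P : PadicG3ParN n)

/-! ### `CondFloorN` against `CondFloorV` -/

/-- `2^{ŜN} ≤ 2^{ŜG}·(2N)` (real; `N_q = K`). [folklore] -/
theorem two_pow_SdN_le_mul_N (hNq : P.Nq = P.K) : (2 : ℝ) ^ P.SdN ≤ 2 ^ P.SdG * (2 * P.N) := by
  have h1 := P.SdN_le hNq
  have h2 : 2 ^ Nat.log 2 P.N ≤ P.N := Nat.pow_log_le_self 2 (by have := P.hN; omega)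
  have h3 : 2 ^ P.SdN ≤ 2 ^ P.SdG * (2 * P.N) := by
    calc 2 ^ P.SdN ≤ 2 ^ (P.SdG + Nat.log 2 P.N + 1) := Nat.pow_le_pow_right (by norm_num) h1
      _ = 2 ^ P.SdG * (2 * 2 ^ Nat.log 2 P.N) := by rw [pow_add, pow_succ]; ring
      _ ≤ 2 ^ P.SdG * (2 * P.N) := Nat.mul_le_mul_left _ (Nat.mul_le_mul_left _ h2)
  exact_mod_cast h3

/-- **`CondFloorN ν ≤ 2N·CondFloorV ν`**. [folklore] -/
theorem CondFloorN_le_mul (hNq : P.Nq = P.K) (ν : ℕ) : P.CondFloorN ν ≤ 2 * P.N * P.CondFloorV ν := by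
  unfold CondFloorN PadicG3Par.CondFloorV
  have h := P.two_pow_SdN_le_mul_N hNq
  obtain ⟨_, hκ0⟩ := P.kappa_le_one
  have hg : 0 ≤ P.g := by linarith [P.one_le_g]
  have h0 : 0 ≤ (2 : ℝ) ^ (ν + 1) * P.g * P.XV * (Real.log P.p / (P.p - 1)) := by positivity
  calc (2 : ℝ) ^ (ν + 1) * 2 ^ P.SdN * P.g * P.XV * (Real.log P.p / (P.p - 1))
      = 2 ^ P.SdN * (2 ^ (ν + 1) * P.g * P.XV * (Real.log P.p / (P.p - 1))) := by ring
    _ ≤ 2 ^ P.SdG * (2 * P.N) * (2 ^ (ν + 1) * P.g * P.XV * (Real.log P.p / (P.p - 1))) :=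
        mul_le_mul_of_nonneg_right h h0
    _ = 2 * P.N * (2 ^ (ν + 1) * 2 ^ P.SdG * P.g * P.XV * (Real.log P.p / (P.p - 1))) := by ring

/-- **`CondFloorN ν ≤ 2·(2/log 2)ⁿ·Ω·CondFloorV ν`** (field `hNΩ`). [folklore] -/
theorem CondFloorN_le_Ω_mul (hNq : P.Nq = P.K) (ν : ℕ) :
    P.CondFloorN ν ≤ 2 * ((2 / Real.log 2) ^ n * P.Ω) * P.CondFloorV ν := by
  have h := P.CondFloorN_le_mul hNq ν
  have hN := P.hNΩ
  have hC0 : 0 ≤ P.CondFloorV ν := by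
    unfold PadicG3Par.CondFloorV
    obtain ⟨_, hκ0⟩ := P.kappa_le_one
    have hg : 0 ≤ P.g := by linarith [P.one_le_g]
    positivity
  nlinarith [mul_le_mul_of_nonneg_right hN hC0]

/-! ### The `m = 0` headline -/

/-- the Ω-free floor bound at `m = 0`: **`CondFloorV n ≤ 424·2^{2n+20}·(log p)²·Wp`** (the core of VM's `CondFloorV_le_main`,
stopped before the insertion of `Ω ≥ 1`). [folklore] -/
theorem CondFloorV_le_zero_core (hm : P.m = 0) (hθ : P.θ₀ = 1 / 2) (hn2 : 2 ≤ n) (hA1 : ∀ j, 1 ≤ P.A j)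
    (hAmaxΩ : P.Amax ≤ 2 ^ n * P.Ω) (hNq : P.Nq = P.K) (hK₀ : (P.K₀ : ℝ) = P.p - 1) :
    P.CondFloorV n ≤ 424 * 2 ^ (n + n + 20) * Real.log P.p ^ 2 * P.Wp := by
  have h0 := P.CondFloorV_le n
  have hX := P.XV_le_main hm hθ hn2 hA1 hAmaxΩ hNq hK₀
  rw [P.Wplus_eq_Wp] at hX
  have hl := P.log_p_pos
  obtain ⟨hlW, _, _, _⟩ := P.Wplus_facts hA1
  rw [P.Wplus_eq_Wp] at hlW
  have hWp0 : 0 ≤ P.Wp := by linarith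
  have hp : (2 : ℝ) ≤ P.p := P.two_le_p
  have hK : (P.K : ℝ) = P.p - 1 := by
    have : (P.K : ℝ) = (P.p : ℝ) ^ P.m * P.K₀ := by unfold PadicG3Par.K; push_cast; ring
    rw [this, hm, pow_zero, one_mul, hK₀]
  have hNqR : (P.Nq : ℝ) = P.p - 1 := by rw [← hK]; exact_mod_cast hNq
  have hp1 : (P.p : ℝ) - 1 ≠ 0 := by linarith
  have hNql : (P.Nq : ℝ) * (Real.log P.p / (P.p - 1)) = Real.log P.p := by
    rw [hNqR, ← mul_div_assoc, mul_div_cancel_left₀ _ hp1]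
  have hg : P.g = Real.log P.p / (16 * (n + 1)) := by
    unfold PadicG3Par.g cG; rw [P.G_eq_half_log hm hθ]; field_simp; ring
  have e0 : (2 : ℝ) ^ (n + n + 27) * P.Nq * P.g ^ 2 * P.XV * (Real.log P.p / (P.p - 1)) =
      2 ^ (n + n + 27) * P.g ^ 2 * P.XV * (P.Nq * (Real.log P.p / (P.p - 1))) := by ring
  rw [e0, hNql, hg] at h0
  have hn1 : (0 : ℝ) < (n : ℝ) + 1 := by positivity
  have step : (2 : ℝ) ^ (n + n + 27) * (Real.log P.p / (16 * (n + 1))) ^ 2 * P.XV * Real.log P.p ≤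
      2 ^ (n + n + 27) * (Real.log P.p / (16 * (n + 1))) ^ 2 * (424 * (n + 1) * (n + 2) * P.Wp / Real.log P.p) * Real.log P.p := by
    have h00 : (0 : ℝ) ≤ 2 ^ (n + n + 27) * (Real.log P.p / (16 * (n + 1))) ^ 2 := by positivity
    exact mul_le_mul_of_nonneg_right (mul_le_mul_of_nonneg_left hX h00) hl.le
  have e1 : (2 : ℝ) ^ (n + n + 27) * (Real.log P.p / (16 * (n + 1))) ^ 2 * (424 * (n + 1) * (n + 2) * P.Wp / Real.log P.p) * Real.log P.p =
      424 * 2 ^ (n + n + 19) * ((n + 2) / (n + 1)) * Real.log P.p ^ 2 * P.Wp := by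
    have e : (2 : ℝ) ^ (n + n + 27) = 2 ^ (n + n + 19) * 2 ^ 8 := by rw [← pow_add]
    rw [e]; field_simp; ring
  have hratio : ((n : ℝ) + 2) / (n + 1) ≤ 2 := by rw [div_le_iff₀ hn1]; linarith
  have h00 : (0 : ℝ) ≤ 424 * 2 ^ (n + n + 19) := by positivity
  have h01 : (0 : ℝ) ≤ Real.log P.p ^ 2 * P.Wp := by positivity
  have := mul_le_mul_of_nonneg_left hratio h00
  have e2 : (424 : ℝ) * 2 ^ (n + n + 20) = 424 * 2 ^ (n + n + 19) * 2 := by rw [pow_succ]; ring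
  calc P.CondFloorV n ≤ 424 * 2 ^ (n + n + 19) * ((n + 2) / (n + 1)) * Real.log P.p ^ 2 * P.Wp := by
        rw [← e1]; exact h0.trans step
    _ = (424 * 2 ^ (n + n + 19) * ((n + 2) / (n + 1))) * (Real.log P.p ^ 2 * P.Wp) := by ring
    _ ≤ (424 * 2 ^ (n + n + 19) * 2) * (Real.log P.p ^ 2 * P.Wp) := mul_le_mul_of_nonneg_right this h01
    _ = 424 * 2 ^ (n + n + 20) * Real.log P.p ^ 2 * P.Wp := by rw [e2]; ring

/-- at `m = 0`: **`CondFloorN n ≤ 2^{4n+37}·(p/log p)·Ω·Wp`** (`2N ≤ 2(2/log 2)ⁿΩ ≤ 2·3ⁿΩ`, `(log p)³ ≤ 64p`). [folklore] -/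
theorem CondFloorN_le_zero (hm : P.m = 0) (hθ : P.θ₀ = 1 / 2) (hn2 : 2 ≤ n) (hA1 : ∀ j, 1 ≤ P.A j)
    (hAmaxΩ : P.Amax ≤ 2 ^ n * P.Ω) (hNq : P.Nq = P.K) (hK₀ : (P.K₀ : ℝ) = P.p - 1) :
    P.CondFloorN n ≤ 2 ^ (4 * n + 37) * (P.p / Real.log P.p) * P.Ω * P.Wp := by
  have h1 := P.CondFloorN_le_Ω_mul hNq n
  have h2 := P.CondFloorV_le_zero_core hm hθ hn2 hA1 hAmaxΩ hNq hK₀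
  have hl := P.log_p_pos
  have hΩ := P.Ω_pos
  obtain ⟨hlW, _, _, _⟩ := P.Wplus_facts hA1
  rw [P.Wplus_eq_Wp] at hlW
  have hWp0 : 0 ≤ P.Wp := by linarith
  -- `(log p)^3 ≤ 64 p`
  have hq := P.log_p_le_four_exp
  have hq4 := P.exp_log_div_four_pow
  have hq1 : 1 ≤ Real.exp (Real.log P.p / 4) := Real.one_le_exp (by positivity)
  have hl3 : Real.log P.p ^ 3 ≤ 64 * P.p := by
    have ha : Real.log P.p ^ 3 ≤ (4 * Real.exp (Real.log P.p / 4)) ^ 3 := pow_le_pow_left₀ hl.le hq 3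
    have hb : Real.exp (Real.log P.p / 4) ^ 3 ≤ Real.exp (Real.log P.p / 4) ^ 4 := pow_le_pow_right₀ hq1 (by norm_num)
    nlinarith
  have hl2 : Real.log P.p ^ 2 ≤ 64 * (P.p / Real.log P.p) := by
    rw [mul_div_assoc', le_div_iff₀ hl]; nlinarith
  -- `(2/log 2)ⁿ ≤ 3ⁿ ≤ 4ⁿ = 2^{2n}`
  have h3 : (2 / Real.log 2) ^ n ≤ (2 : ℝ) ^ (2 * n) := by
    have hl2' : Real.log 2 > 0.6931471803 := Real.log_two_gt_d9
    have hle : (2 : ℝ) / Real.log 2 ≤ 4 := by rw [div_le_iff₀ (by linarith)]; linarith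
    calc (2 / Real.log 2) ^ n ≤ (4 : ℝ) ^ n := pow_le_pow_left₀ (by positivity) hle n
      _ = 2 ^ (2 * n) := by rw [pow_mul]; norm_num
  -- assemble
  have hC0 : 0 ≤ P.CondFloorV n := by
    unfold PadicG3Par.CondFloorV
    obtain ⟨_, hκ0⟩ := P.kappa_le_one
    have hg : 0 ≤ P.g := by linarith [P.one_le_g]
    positivity
  have h4 : P.CondFloorN n ≤ 2 * (2 ^ (2 * n) * P.Ω) * (424 * 2 ^ (n + n + 20) * Real.log P.p ^ 2 * P.Wp) := by
    calc P.CondFloorN n ≤ 2 * ((2 / Real.log 2) ^ n * P.Ω) * P.CondFloorV n := h1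
      _ ≤ 2 * (2 ^ (2 * n) * P.Ω) * P.CondFloorV n := by
          apply mul_le_mul_of_nonneg_right _ hC0
          exact mul_le_mul_of_nonneg_left (mul_le_mul_of_nonneg_right h3 hΩ.le) (by norm_num)
      _ ≤ 2 * (2 ^ (2 * n) * P.Ω) * (424 * 2 ^ (n + n + 20) * Real.log P.p ^ 2 * P.Wp) :=
          mul_le_mul_of_nonneg_left h2 (by positivity)
  have h5 : 2 * (2 ^ (2 * n) * P.Ω) * (424 * 2 ^ (n + n + 20) * Real.log P.p ^ 2 * P.Wp) ≤
      2 * (2 ^ (2 * n) * P.Ω) * (424 * 2 ^ (n + n + 20) * (64 * (P.p / Real.log P.p)) * P.Wp) := by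
    have h00 : (0 : ℝ) ≤ 2 * (2 ^ (2 * n) * P.Ω) := by positivity
    apply mul_le_mul_of_nonneg_left _ h00
    have h01 : (0 : ℝ) ≤ 424 * 2 ^ (n + n + 20) := by positivity
    nlinarith [mul_le_mul_of_nonneg_left hl2 (mul_nonneg h01 hWp0)]
  have e : 2 * (2 ^ (2 * n) * P.Ω) * (424 * 2 ^ (n + n + 20) * (64 * (P.p / Real.log P.p)) * P.Wp) =
      (848 * 64) * 2 ^ (4 * n + 20) * (P.p / Real.log P.p) * P.Ω * P.Wp := by
    have : (2 : ℝ) ^ (4 * n + 20) = 2 ^ (2 * n) * 2 ^ (n + n + 20) := by rw [← pow_add]; ring_nf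
    rw [this]; ring
  have h6 : (848 * 64 : ℝ) * 2 ^ (4 * n + 20) ≤ 2 ^ (4 * n + 37) := by
    have e6 : (2 : ℝ) ^ (4 * n + 37) = 2 ^ (4 * n + 20) * 2 ^ 17 := by rw [← pow_add]
    rw [e6]; nlinarith [pow_pos (two_pos (α := ℝ)) (4 * n + 20)]
  have hB0 : 0 ≤ (P.p : ℝ) / Real.log P.p * P.Ω * P.Wp := by positivity
  calc P.CondFloorN n ≤ (848 * 64) * 2 ^ (4 * n + 20) * (P.p / Real.log P.p) * P.Ω * P.Wp := by rw [← e]; exact h4.trans h5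
    _ = (848 * 64) * 2 ^ (4 * n + 20) * ((P.p / Real.log P.p) * P.Ω * P.Wp) := by ring
    _ ≤ 2 ^ (4 * n + 37) * ((P.p / Real.log P.p) * P.Ω * P.Wp) := mul_le_mul_of_nonneg_right h6 hB0
    _ = _ := by ring

/-- **THE `m = 0` HEADLINE of the N-record: `2·(8·2ⁿ·Zp + CondFloorN n) ≤ (2^100)ⁿ·(p/log p)·Ω·Wp`.**
[cite: Yu2013, Theorem 1 (shape)] -/
theorem headline_N_zero (hm : P.m = 0) (hθ : P.θ₀ = 1 / 2) (hn2 : 2 ≤ n) (hA1 : ∀ j, 1 ≤ P.A j)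
    (hAmaxΩ : P.Amax ≤ 2 ^ n * P.Ω) (hNq : P.Nq = P.K) (hK₀ : (P.K₀ : ℝ) = P.p - 1) :
    2 * (8 * 2 ^ n * P.Zp + P.CondFloorN n) ≤ ((2 : ℝ) ^ 100) ^ n * (P.p / Real.log P.p) * P.Ω * P.Wp := by
  have h1 := P.main_term_le hm hθ hn2 hA1 hAmaxΩ hNq hK₀
  rw [P.Wplus_eq_Wp] at h1
  have h2 := P.CondFloorN_le_zero hm hθ hn2 hA1 hAmaxΩ hNq hK₀
  have hl := P.log_p_pos
  have hΩ := P.Ω_pos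
  obtain ⟨hlW, _, _, _⟩ := P.Wplus_facts hA1
  rw [P.Wplus_eq_Wp] at hlW
  have hWp0 : 0 ≤ P.Wp := by linarith
  have hB0 : 0 ≤ (P.p : ℝ) / Real.log P.p * P.Ω * P.Wp := by positivity
  -- `(8 C_b)ⁿ ≤ 2^{10 n}`
  have h8Cb : (8 * Cb) ^ n ≤ (2 : ℝ) ^ (10 * n) := by
    have h : 8 * Cb ≤ (2 : ℝ) ^ 10 := by have := sixteen_Cb_le; nlinarith [Cb_pos]
    calc (8 * Cb) ^ n ≤ ((2 : ℝ) ^ 10) ^ n := pow_le_pow_left₀ (by have := Cb_pos; positivity) h n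
      _ = 2 ^ (10 * n) := by rw [← pow_mul]
  -- constants: `2·(424·2^{n+34}·2^{10n} + 2^{4n+37}) ≤ 2^{100 n}`
  have hmain : 8 * 2 ^ n * P.Zp ≤ 424 * 2 ^ (n + 34) * 2 ^ (10 * n) * ((P.p / Real.log P.p) * P.Ω * P.Wp) := by
    calc 8 * 2 ^ n * P.Zp ≤ 424 * 2 ^ (n + 34) * (8 * Cb) ^ n * (P.p / Real.log P.p) * P.Ω * P.Wp := h1
      _ = 424 * 2 ^ (n + 34) * (8 * Cb) ^ n * ((P.p / Real.log P.p) * P.Ω * P.Wp) := by ring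
      _ ≤ 424 * 2 ^ (n + 34) * 2 ^ (10 * n) * ((P.p / Real.log P.p) * P.Ω * P.Wp) := by
          apply mul_le_mul_of_nonneg_right _ hB0
          exact mul_le_mul_of_nonneg_left h8Cb (by positivity)
  have hsum : 2 * (424 * 2 ^ (n + 34) * 2 ^ (10 * n) + 2 ^ (4 * n + 37)) ≤ ((2 : ℝ) ^ 100) ^ n := by
    rw [← pow_mul]
    have e1 : (424 : ℝ) * 2 ^ (n + 34) * 2 ^ (10 * n) ≤ 2 ^ (11 * n + 43) := by
      have : (2 : ℝ) ^ (11 * n + 43) = 2 ^ 9 * (2 ^ (n + 34) * 2 ^ (10 * n)) := by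
        rw [← pow_add, ← pow_add]; ring_nf
      rw [this]; nlinarith [pow_pos (two_pos (α := ℝ)) (n + 34), pow_pos (two_pos (α := ℝ)) (10 * n)]
    have e2 : (2 : ℝ) ^ (4 * n + 37) ≤ 2 ^ (11 * n + 43) := pow_le_pow_right₀ (by norm_num) (by omega)
    have e3 : (2 : ℝ) * (2 ^ (11 * n + 43) + 2 ^ (11 * n + 43)) = 2 ^ (11 * n + 45) := by
      rw [show 11 * n + 45 = (11 * n + 43) + 2 by omega, pow_add]; ring
    have e4 : (2 : ℝ) ^ (11 * n + 45) ≤ 2 ^ (100 * n) := pow_le_pow_right₀ (by norm_num) (by omega)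
    linarith
  calc 2 * (8 * 2 ^ n * P.Zp + P.CondFloorN n)
      ≤ 2 * (424 * 2 ^ (n + 34) * 2 ^ (10 * n) * ((P.p / Real.log P.p) * P.Ω * P.Wp) +
          2 ^ (4 * n + 37) * ((P.p / Real.log P.p) * P.Ω * P.Wp)) := by linarith
    _ = 2 * (424 * 2 ^ (n + 34) * 2 ^ (10 * n) + 2 ^ (4 * n + 37)) * ((P.p / Real.log P.p) * P.Ω * P.Wp) := by ring
    _ ≤ ((2 : ℝ) ^ 100) ^ n * ((P.p / Real.log P.p) * P.Ω * P.Wp) := mul_le_mul_of_nonneg_right hsum hB0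
    _ = _ := by ring

/-! ### The budget letter is below the floor -/

/-- `W + log p ≤ 8·2ⁿ·Zp` (`W ≤ W_LV ≤ Zp/128`, `log p ≤ 2G ≤ Zp/2^31`, `½ ≤ θ₀`). [folklore] -/
theorem W_add_log_p_le_floor (hθ : 1 / 2 ≤ P.θ₀) : P.W + Real.log P.p ≤ 8 * 2 ^ n * P.Zp := by
  have h1 := P.WLV_le_Zp
  have h2 : P.W ≤ P.WLV := by
    have h := P.W_add_log_le_WLV
    have : 0 ≤ Real.log (2 * (P.LV : ℝ)) := Real.log_nonneg (by linarith [P.one_le_LV])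
    linarith
  have h3 := P.log_p_le_two_G hθ
  obtain ⟨hGt, _, _, _, _⟩ := P.tinyV
  have hZ := P.Zp_facts.1
  have h2n : (1 : ℝ) ≤ 2 ^ n := one_le_pow₀ (by norm_num)
  nlinarith

end PadicG3ParN

namespace G3Setup

variable {p : ℕ} [Fact p.Prime] (S : G3Setup p)

/-- **THE SMALLNESS LINE OF THE N-RECORD** (every `m`): from the negated bound `¬ ord_p(∏αⱼ^{bⱼ} − 1)·log p ≤ R`,
the budget letter `log max(3,|bⱼ|) ≤ P.W`, and a headline `2·(8·2ⁿ·Zp + CondFloorN n) ≤ R`, a real `U` with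
`‖Λ/b_{j₀}‖_p ≤ e^{−U}` and `8·2ⁿ·Zp + CondFloorN n ≤ U` — the `hU` of `hKlam_N`/`hHlam_N`. [cite: Yu2013, §7; shape only] -/
theorem U_floor_of_headline (P : PadicG3ParN S.n) (hPp : P.p = p) (hθ : 1 / 2 ≤ P.θ₀)
    (hWb : ∀ j, Real.log (max 3 (|S.b j| : ℝ)) ≤ P.W) {R : ℝ}
    (hU : ¬ (padicValRat p (∏ j, S.α j ^ S.b j - 1) : ℝ) * Real.log p ≤ R)
    (hR : 2 * (8 * 2 ^ S.n * P.Zp + P.CondFloorN S.n) ≤ R) :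
    ∃ U : ℝ, ‖S.Λ / (S.b S.j₀ : ℚ_[p])‖ ≤ Real.exp (-U) ∧ 8 * 2 ^ S.n * P.Zp + P.CondFloorN S.n ≤ U := by
  have hp : p.Prime := Fact.out
  have hp0 : (0 : ℝ) < p := by exact_mod_cast hp.pos
  have hfloor := P.W_add_log_p_le_floor hθ
  rw [hPp] at hfloor
  have hC0 : 0 ≤ P.CondFloorN S.n := by
    unfold PadicG3ParN.CondFloorN
    obtain ⟨_, hκ0⟩ := P.kappa_le_one
    have hg : 0 ≤ P.g := by linarith [P.one_le_g]
    positivity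
  obtain ⟨E, _, hΛ, hBE, _⟩ := S.expLine_budget hWb hU hR (by linarith)
  refine ⟨(E : ℝ) * Real.log p, ?_, hBE⟩
  rwa [inv_pow_eq_exp_neg hp0] at hΛ

end G3Setup

end Summit.ABC.StewartYu
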